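import Literature.Combinatorics.SimpleGraph.PfaffianBipartite
import HarnessLib

/-!
# Route PolyaContinued — support item `SignedCoverLittle` (stmt-ValiantsHypothesis-7426):
# the same-board bicontraction of the target, I — the substitution, the target, its matchings

Ingredient (SB) ("the fold") of the E-side chain `stub_chain` of the line `even_induction`
(`Cruxes/SignedCoverLittle/Lines/even_induction.lean`; driver `…SignedCoverLittleChain.lean`):
bicontracting a row of degree two of the TARGET `E ⊆ Fin n × Fin n` of a label identity
`Σ_{σ ⊆ H} Π X (φ (i, σ i)) = PM_E` (cf. `…SignedCoverLittleReduction.lean`, `…Bijection.lean`) WITHOUT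
leaving the board `Fin n × Fin n` and without constants, so that the label identity survives.

Let row `a` of `E` consist of exactly the two cells `(a, b₀)`, `(a, b₁)` (`b₀ ≠ b₁`) and let no
other row see both columns `b₀`, `b₁` (no parallel row; automatic in a deletion-minimal
non-Pfaffian target, `…SignedCoverLittleNoParallel.lean`). The cell substitution `sbSubst a b₀ b₁`

  `(r, b₁) ↦ (r, b₀)` for `r ≠ a`,  `(a, b₀) ↦ (a, b₁)`,  every other cell fixed,

maps `E` onto `sbTarget E a b₀ b₁ := E.image (sbSubst a b₀ b₁)`: the columns `b₀`, `b₁` are merged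
into `b₀` off row `a`, and row `a` keeps the single, forced, cell `(a, b₁)` — the bicontraction of
the vertex `a` (Robertson–Seymour–Thomas §4) realised on the same board, the contracted vertex
surviving as a forced matching edge.

* `sbSubst_apply_of_apply_eq_right/left` — on the cells of a perfect matching `π`: if `π a = b₁`
  every cell is fixed; if `π a = b₀` the cells of `π` go to the cells of `swap b₀ b₁ * π`;
* `mem_sbTarget_iff` (+ row `a`, the merged column, the other columns) — the cells of the target;
* `forall_mem_sbTarget_iff`, `not_both_of_noParallel` — its perfect matchings: `ρ` with
  `ρ a = b₁` such that `ρ` or `swap b₀ b₁ * ρ` (never both) is a perfect matching of `E`;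
* `card_sbTarget_add_one` — **(SB4)** the target has exactly one cell fewer than `E`.

The polynomial identity (SB1), the transport of the label identity (SB2) and of Pfaffian-ness
(SB3), and the packaged `exists_fold` are in `…SignedCoverLittleFold.lean`. Rows = columns are
indexed by any type `V` with decidable equality (the route: `V = Fin n`).
-/

noncomputable section

namespace Summit.ValiantsHypothesis.PolyaContinued

open Finset Equiv

variable {V : Type*} [DecidableEq V]

/-! ### The substitution and the target -/

/-- **Same-board bicontraction substitution** of cells: `(r, b₁) ↦ (r, b₀)` for `r ≠ a`,
`(a, b₀) ↦ (a, b₁)`, everything else fixed. [folklore] -/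
def sbSubst (a b₀ b₁ : V) (e : V × V) : V × V :=
  if e.2 = b₁ ∧ e.1 ≠ a then (e.1, b₀) else if e = (a, b₀) then (a, b₁) else e

/-- **Same-board bicontraction of the target** at row `a` (cells `(a, b₀)`, `(a, b₁)`): the image
of `E` under `sbSubst a b₀ b₁`. [folklore] -/
def sbTarget (E : Finset (V × V)) (a b₀ b₁ : V) : Finset (V × V) :=
  E.image (sbSubst a b₀ b₁)

/-- `sbSubst` on a cell of column `b₁` off row `a`. [folklore] -/
theorem sbSubst_apply_col (a b₀ b₁ r : V) (hr : r ≠ a) : sbSubst a b₀ b₁ (r, b₁) = (r, b₀) := by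
  unfold sbSubst
  rw [if_pos ⟨rfl, hr⟩]

/-- `sbSubst (a, b₀) = (a, b₁)`. [folklore] -/
theorem sbSubst_apply_left (a : V) {b₀ b₁ : V} (hb : b₀ ≠ b₁) :
    sbSubst a b₀ b₁ (a, b₀) = (a, b₁) := by
  unfold sbSubst
  rw [if_neg (fun h => hb h.1), if_pos rfl]

/-- `sbSubst` fixes every cell outside column `b₁` (or in row `a`) other than `(a, b₀)`.
[folklore] -/
theorem sbSubst_apply_of_ne (a b₀ b₁ : V) (e : V × V) (h₁ : e.2 ≠ b₁ ∨ e.1 = a)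
    (h₀ : e ≠ (a, b₀)) : sbSubst a b₀ b₁ e = e := by
  unfold sbSubst
  rw [if_neg, if_neg h₀]
  rintro ⟨h, h'⟩
  rcases h₁ with h₁ | h₁
  · exact h₁ h
  · exact h' h₁

/-- `sbSubst` fixes `(a, b₁)`. [folklore] -/
theorem sbSubst_apply_right (a b₀ b₁ : V) : sbSubst a b₀ b₁ (a, b₁) = (a, b₁) := by
  unfold sbSubst
  rw [if_neg (fun h => h.2 rfl)]
  split_ifs <;> rfl

/-- **The cells of a perfect matching through `(a, b₁)` are fixed.** [folklore] -/
theorem sbSubst_apply_of_apply_eq_right {a b₀ b₁ : V} (π : Perm V) (hπ : π a = b₁) (i : V) :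
    sbSubst a b₀ b₁ (i, π i) = (i, π i) := by
  by_cases hi : i = a
  · subst hi
    rw [hπ]
    exact sbSubst_apply_right i b₀ b₁
  · refine sbSubst_apply_of_ne a b₀ b₁ _ (Or.inl fun h => hi ?_) fun h => hi (Prod.mk_inj.1 h).1
    exact π.injective (h.trans hπ.symm)

/-- **The cells of a perfect matching through `(a, b₀)` go to the cells of `swap b₀ b₁ * π`.**
[folklore] -/
theorem sbSubst_apply_of_apply_eq_left {a b₀ b₁ : V} (hb : b₀ ≠ b₁) (π : Perm V)
    (hπ : π a = b₀) (i : V) :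
    sbSubst a b₀ b₁ (i, π i) = (i, (Equiv.swap b₀ b₁ * π) i) := by
  rw [Perm.mul_apply]
  by_cases hi : i = a
  · subst hi
    rw [hπ, swap_apply_left]
    exact sbSubst_apply_left i hb
  · by_cases hπi : π i = b₁
    · rw [hπi, swap_apply_right]
      exact sbSubst_apply_col a b₀ b₁ i hi
    · have hπi0 : π i ≠ b₀ := fun h => hi (π.injective (h.trans hπ.symm))
      rw [swap_apply_of_ne_of_ne hπi0 hπi]
      exact sbSubst_apply_of_ne a b₀ b₁ _ (Or.inl hπi) fun h => hi (Prod.mk_inj.1 h).1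

/-! ### Cells and perfect matchings of the target -/

/-- **The cells of the same-board bicontraction**: the forced cell `(a, b₁)`; in column `b₀`, off
row `a`, the rows that saw `b₀` or `b₁`; and, outside the columns `b₀, b₁` and row `a`, the cells
of `E`. (Column `b₁` off row `a` and row `a` off column `b₁` are empty.) [folklore] -/
theorem mem_sbTarget_iff {E : Finset (V × V)} {a b₀ b₁ : V} (hb : b₀ ≠ b₁)
    (hrow : ∀ c, (a, c) ∈ E ↔ c = b₀ ∨ c = b₁) (r c : V) :
    (r, c) ∈ sbTarget E a b₀ b₁ ↔
      (r = a ∧ c = b₁) ∨ (r ≠ a ∧ c = b₀ ∧ ((r, b₀) ∈ E ∨ (r, b₁) ∈ E)) ∨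
        (r ≠ a ∧ c ≠ b₀ ∧ c ≠ b₁ ∧ (r, c) ∈ E) := by
  unfold sbTarget
  rw [Finset.mem_image]
  constructor
  · rintro ⟨⟨r', c'⟩, he, hS⟩
    by_cases h1 : c' = b₁ ∧ r' ≠ a
    · obtain ⟨hc', hr'⟩ := h1
      subst hc'
      rw [sbSubst_apply_col a b₀ _ r' hr'] at hS
      obtain ⟨hrr, hcc⟩ := Prod.mk_inj.1 hS
      subst hrr
      exact Or.inr (Or.inl ⟨hr', hcc.symm, Or.inr he⟩)
    · by_cases h0 : ((r', c') : V × V) = (a, b₀)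
      · rw [h0, sbSubst_apply_left a hb] at hS
        obtain ⟨hrr, hcc⟩ := Prod.mk_inj.1 hS
        exact Or.inl ⟨hrr.symm, hcc.symm⟩
      · have hfix : sbSubst a b₀ b₁ (r', c') = (r', c') := by
          refine sbSubst_apply_of_ne a b₀ b₁ (r', c') ?_ h0
          by_cases hc : c' = b₁
          · right
            by_contra hr
            exact h1 ⟨hc, hr⟩
          · exact Or.inl hc
        rw [hfix] at hS
        obtain ⟨hrr, hcc⟩ := Prod.mk_inj.1 hS
        subst hrr; subst hcc
        by_cases hr : r' = a
        · subst hr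
          rcases (hrow c').1 he with h | h
          · exact absurd (by rw [h]) h0
          · exact Or.inl ⟨rfl, h⟩
        · have hc1 : c' ≠ b₁ := fun hc => h1 ⟨hc, hr⟩
          by_cases hc0 : c' = b₀
          · subst hc0
            exact Or.inr (Or.inl ⟨hr, rfl, Or.inl he⟩)
          · exact Or.inr (Or.inr ⟨hr, hc0, hc1, he⟩)
  · rintro (⟨hr, hc⟩ | ⟨hr, hc, hE | hE⟩ | ⟨hr, hc0, hc1, hE⟩)
    · rw [hr, hc]
      exact ⟨(a, b₀), (hrow b₀).2 (Or.inl rfl), sbSubst_apply_left a hb⟩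
    · rw [hc]
      exact ⟨(r, b₀), hE,
        sbSubst_apply_of_ne a b₀ b₁ _ (Or.inl hb) fun h => hr (Prod.mk_inj.1 h).1⟩
    · rw [hc]
      exact ⟨(r, b₁), hE, sbSubst_apply_col a b₀ b₁ r hr⟩
    · exact ⟨(r, c), hE,
        sbSubst_apply_of_ne a b₀ b₁ _ (Or.inl hc1) fun h => hr (Prod.mk_inj.1 h).1⟩

/-- Row `a` of the target is the single cell `(a, b₁)`. [folklore] -/
theorem mem_sbTarget_row_iff {E : Finset (V × V)} {a b₀ b₁ : V} (hb : b₀ ≠ b₁)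
    (hrow : ∀ c, (a, c) ∈ E ↔ c = b₀ ∨ c = b₁) (c : V) :
    (a, c) ∈ sbTarget E a b₀ b₁ ↔ c = b₁ := by
  rw [mem_sbTarget_iff hb hrow]
  constructor
  · rintro (⟨-, h⟩ | ⟨h, -⟩ | ⟨h, -⟩)
    · exact h
    · exact absurd rfl h
    · exact absurd rfl h
  · intro h
    exact Or.inl ⟨rfl, h⟩

/-- The merged column: for `r ≠ a`, `(r, b₀)` is a cell of the target iff `r` saw `b₀` or `b₁`
in `E`. [folklore] -/
theorem mem_sbTarget_col_iff {E : Finset (V × V)} {a b₀ b₁ : V} (hb : b₀ ≠ b₁)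
    (hrow : ∀ c, (a, c) ∈ E ↔ c = b₀ ∨ c = b₁) {r : V} (hr : r ≠ a) :
    (r, b₀) ∈ sbTarget E a b₀ b₁ ↔ (r, b₀) ∈ E ∨ (r, b₁) ∈ E := by
  rw [mem_sbTarget_iff hb hrow]
  constructor
  · rintro (⟨h, -⟩ | ⟨-, -, h⟩ | ⟨-, h, -⟩)
    · exact absurd h hr
    · exact h
    · exact absurd rfl h
  · intro h
    exact Or.inr (Or.inl ⟨hr, rfl, h⟩)

/-- Outside the columns `b₀, b₁`, the target and `E` have the same cells. [folklore] -/
theorem mem_sbTarget_iff_of_ne {E : Finset (V × V)} {a b₀ b₁ : V} (hb : b₀ ≠ b₁)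
    (hrow : ∀ c, (a, c) ∈ E ↔ c = b₀ ∨ c = b₁) {r c : V} (hc0 : c ≠ b₀) (hc1 : c ≠ b₁) :
    (r, c) ∈ sbTarget E a b₀ b₁ ↔ (r, c) ∈ E := by
  rw [mem_sbTarget_iff hb hrow]
  constructor
  · rintro (⟨-, h⟩ | ⟨-, h, -⟩ | ⟨-, -, -, h⟩)
    · exact absurd h hc1
    · exact absurd h hc0
    · exact h
  · intro h
    by_cases hr : r = a
    · subst hr
      rcases (hrow c).1 h with h' | h'
      · exact absurd h' hc0
      · exact absurd h' hc1
    · exact Or.inr (Or.inr ⟨hr, hc0, hc1, h⟩)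

/-- **A perfect matching of `E` through `(a, b₁)` is a perfect matching of the target** (its
cells are fixed by the substitution). [folklore] -/
theorem forall_mem_sbTarget_of_apply_eq_right {E : Finset (V × V)} {a b₀ b₁ : V}
    {π : Perm V} (hπE : ∀ i, (i, π i) ∈ E) (hπ : π a = b₁) :
    ∀ i, (i, π i) ∈ sbTarget E a b₀ b₁ := fun i => by
  unfold sbTarget
  rw [Finset.mem_image]
  exact ⟨(i, π i), hπE i, sbSubst_apply_of_apply_eq_right π hπ i⟩

/-- **A perfect matching `π` of `E` through `(a, b₀)` yields the perfect matching
`swap b₀ b₁ * π` of the target.** [folklore] -/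
theorem forall_mem_sbTarget_of_apply_eq_left {E : Finset (V × V)} {a b₀ b₁ : V} (hb : b₀ ≠ b₁)
    {π : Perm V} (hπE : ∀ i, (i, π i) ∈ E) (hπ : π a = b₀) :
    ∀ i, (i, (Equiv.swap b₀ b₁ * π) i) ∈ sbTarget E a b₀ b₁ := fun i => by
  unfold sbTarget
  rw [Finset.mem_image]
  exact ⟨(i, π i), hπE i, sbSubst_apply_of_apply_eq_left hb π hπ i⟩

/-- **The perfect matchings of the target**: a permutation `ρ` is a perfect matching of the target
iff `ρ a = b₁` and `ρ` itself or `swap b₀ b₁ * ρ` is a perfect matching of `E`. [folklore] -/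
theorem forall_mem_sbTarget_iff {E : Finset (V × V)} {a b₀ b₁ : V} (hb : b₀ ≠ b₁)
    (hrow : ∀ c, (a, c) ∈ E ↔ c = b₀ ∨ c = b₁) (ρ : Perm V) :
    (∀ i, (i, ρ i) ∈ sbTarget E a b₀ b₁) ↔
      ρ a = b₁ ∧ ((∀ i, (i, ρ i) ∈ E) ∨ ∀ i, (i, (Equiv.swap b₀ b₁ * ρ) i) ∈ E) := by
  constructor
  · intro h
    have hρa : ρ a = b₁ := (mem_sbTarget_row_iff hb hrow (ρ a)).1 (h a)
    refine ⟨hρa, ?_⟩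
    -- the row matched to `b₀`
    obtain ⟨r₀, hρr₀⟩ : ∃ r₀, ρ r₀ = b₀ := ⟨ρ.symm b₀, ρ.apply_symm_apply b₀⟩
    have hr₀a : r₀ ≠ a := by
      intro h'
      rw [h', hρa] at hρr₀
      exact hb hρr₀.symm
    -- the common cells
    have hcommon : ∀ i, i ≠ a → i ≠ r₀ → (i, ρ i) ∈ E ∧ Equiv.swap b₀ b₁ (ρ i) = ρ i := by
      intro i hia hir
      have h0 : ρ i ≠ b₀ := fun e => hir (ρ.injective (e.trans hρr₀.symm))
      have h1 : ρ i ≠ b₁ := fun e => hia (ρ.injective (e.trans hρa.symm))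
      exact ⟨(mem_sbTarget_iff_of_ne hb hrow h0 h1).1 (h i), swap_apply_of_ne_of_ne h0 h1⟩
    have hr₀mem : (r₀, b₀) ∈ sbTarget E a b₀ b₁ := by
      have := h r₀
      rwa [hρr₀] at this
    rcases (mem_sbTarget_col_iff hb hrow hr₀a).1 hr₀mem with hE | hE
    · left
      intro i
      by_cases hia : i = a
      · rw [hia, hρa]; exact (hrow b₁).2 (Or.inr rfl)
      by_cases hir : i = r₀
      · rw [hir, hρr₀]; exact hE
      · exact (hcommon i hia hir).1
    · right
      intro i
      rw [Perm.mul_apply]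
      by_cases hia : i = a
      · rw [hia, hρa, swap_apply_right]; exact (hrow b₀).2 (Or.inl rfl)
      by_cases hir : i = r₀
      · rw [hir, hρr₀, swap_apply_left]; exact hE
      · rw [(hcommon i hia hir).2]; exact (hcommon i hia hir).1
  · rintro ⟨hρa, hE | hE⟩
    · exact forall_mem_sbTarget_of_apply_eq_right hE hρa
    · have h := forall_mem_sbTarget_of_apply_eq_left hb hE
        (show (Equiv.swap b₀ b₁ * ρ) a = b₀ by rw [Perm.mul_apply, hρa, swap_apply_right])
      intro i
      have := h i
      rwa [← mul_assoc, Equiv.swap_mul_self, one_mul] at this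

/-- Under the no-parallel-row hypothesis the two kinds do not overlap: `ρ` (with `ρ a = b₁`) and
`swap b₀ b₁ * ρ` are not both perfect matchings of `E` — the row matched to `b₀` by the one and
to `b₁` by the other would see both columns. [folklore] -/
theorem not_both_of_noParallel {E : Finset (V × V)} {a b₀ b₁ : V} (hb : b₀ ≠ b₁)
    (hNP : ∀ r, r ≠ a → ¬((r, b₀) ∈ E ∧ (r, b₁) ∈ E)) {ρ : Perm V} (hρa : ρ a = b₁)
    (h : ∀ i, (i, ρ i) ∈ E) (h' : ∀ i, (i, (Equiv.swap b₀ b₁ * ρ) i) ∈ E) : False := by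
  obtain ⟨r₀, hρr₀⟩ : ∃ r₀, ρ r₀ = b₀ := ⟨ρ.symm b₀, ρ.apply_symm_apply b₀⟩
  have hr₀a : r₀ ≠ a := by
    intro e
    rw [e, hρa] at hρr₀
    exact hb hρr₀.symm
  refine hNP r₀ hr₀a ⟨?_, ?_⟩
  · have := h r₀
    rwa [hρr₀] at this
  · have := h' r₀
    rwa [Perm.mul_apply, hρr₀, swap_apply_left] at this

/-! ### (SB4) One cell fewer -/

/-- Values of `sbSubst` on the cells of `E` other than `(a, b₀)`: a cell of column `b₁` off row `a`
moves to column `b₀`, every other cell is fixed. [folklore] -/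
theorem sbSubst_apply_cases {a b₀ b₁ : V} {r c : V} (h0 : (r, c) ≠ (a, b₀)) :
    (c = b₁ ∧ r ≠ a ∧ sbSubst a b₀ b₁ (r, c) = (r, b₀)) ∨
      (¬(c = b₁ ∧ r ≠ a) ∧ sbSubst a b₀ b₁ (r, c) = (r, c)) := by
  by_cases h : c = b₁ ∧ r ≠ a
  · refine Or.inl ⟨h.1, h.2, ?_⟩
    rw [h.1]
    exact sbSubst_apply_col a b₀ b₁ r h.2
  · refine Or.inr ⟨h, sbSubst_apply_of_ne a b₀ b₁ (r, c) ?_ h0⟩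
    by_cases hc : c = b₁
    · right
      by_contra hr
      exact h ⟨hc, hr⟩
    · exact Or.inl hc

/-- **(SB4) The target has exactly one cell fewer than `E`**: `sbSubst` is injective on
`E ∖ {(a, b₀)}` (no parallel row) and `(a, b₀)`, `(a, b₁)` have the same image. [folklore] -/
theorem card_sbTarget_add_one {E : Finset (V × V)} {a b₀ b₁ : V} (hb : b₀ ≠ b₁)
    (hrow : ∀ c, (a, c) ∈ E ↔ c = b₀ ∨ c = b₁)
    (hNP : ∀ r, r ≠ a → ¬((r, b₀) ∈ E ∧ (r, b₁) ∈ E)) :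
    (sbTarget E a b₀ b₁).card + 1 = E.card := by
  classical
  have hmem0 : (a, b₀) ∈ E := (hrow b₀).2 (Or.inl rfl)
  have hmem1 : (a, b₁) ∈ E.erase (a, b₀) :=
    Finset.mem_erase.2 ⟨fun h => hb.symm (Prod.mk_inj.1 h).2, (hrow b₁).2 (Or.inr rfl)⟩
  -- the image of `E` is the image of `E ∖ {(a, b₀)}`
  have himage : sbTarget E a b₀ b₁ = (E.erase (a, b₀)).image (sbSubst a b₀ b₁) := by
    unfold sbTarget
    conv_lhs => rw [← Finset.insert_erase hmem0]
    rw [Finset.image_insert, sbSubst_apply_left a hb, Finset.insert_eq_of_mem]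
    exact Finset.mem_image.2 ⟨(a, b₁), hmem1, sbSubst_apply_right a b₀ b₁⟩
  -- injectivity off `(a, b₀)`
  have hinj : Set.InjOn (sbSubst a b₀ b₁) (E.erase (a, b₀) : Finset (V × V)) := by
    rintro ⟨r, c⟩ he ⟨r', c'⟩ he' hS
    obtain ⟨hne, hE⟩ := Finset.mem_erase.1 (Finset.mem_coe.1 he)
    obtain ⟨hne', hE'⟩ := Finset.mem_erase.1 (Finset.mem_coe.1 he')
    rcases sbSubst_apply_cases (b₀ := b₀) (b₁ := b₁) hne with ⟨hc, hr, h⟩ | ⟨-, h⟩ <;>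
      rcases sbSubst_apply_cases (b₀ := b₀) (b₁ := b₁) hne' with ⟨hc', hr', h'⟩ | ⟨-, h'⟩
    · rw [h, h'] at hS
      rw [hc, hc', (Prod.mk_inj.1 hS).1]
    · -- `(r, b₀) = (r', c')` with `(r', c')` fixed: `r'` would see both columns
      rw [h, h'] at hS
      obtain ⟨hrr, hcc⟩ := Prod.mk_inj.1 hS
      subst hrr
      refine absurd ⟨?_, ?_⟩ (hNP r hr)
      · rw [hcc]; exact hE'
      · rw [← hc]; exact hE
    · rw [h, h'] at hS
      obtain ⟨hrr, hcc⟩ := Prod.mk_inj.1 hS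
      subst hrr
      refine absurd ⟨?_, ?_⟩ (hNP r hr')
      · rw [← hcc]; exact hE
      · rw [← hc']; exact hE'
    · rw [h, h'] at hS
      exact hS
  rw [himage, Finset.card_image_of_injOn hinj, Finset.card_erase_add_one hmem0]

end Summit.ValiantsHypothesis.PolyaContinued
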